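import Summits.KontsevichZagierPeriods.KontsevichZagierPeriods.Theorems.ValuedFieldSpecialisationCTConstructionCylinder
import Summits.KontsevichZagierPeriods.KontsevichZagierPeriods.Theorems.MzvKernelInKZ.Negative.ScalingDivision

/-!
# Route ValuedFieldSpecialisation — crux `CTConstruction`: all moments of a constant family

Helper toward crux stmt-KontsevichZagierPeriods-3495 (`CTConstruction`), line `registered` (the lead's MOMENT METHOD,
`Cruxes/CTConstruction/LEAD-REPORT-c2.md` §2). For the constant family `ρ.cylinder = (0,1) × ρ` and every `m : ℕ`,
the `m`-th MOMENT — the total class of the family with integrand multiplied by the weight `(z 0)^m` — is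
`[ρ] / (m + 1)` at CLASS level: `(m + 1) • [s^m · ρ.cylinder] − [ρ] ∈ KZ.relations` (`cylinder_moment_total`).
This is the accessible identity `∫₀¹ s^m ds = 1/(m+1)` inside the calculus: one Newton–Leibniz move along the
parameter (primitive `s^{m+1}/(m+1) · ρ`), a coordinate rotation (`KZ.IntegralRep.reindex`), two null faces, and the
derived rule `(m+1) • [ρ/(m+1)] ≡ [ρ]` (`KZ.IntegralRep.constMul`, integrand additivity). The case `m = 1` is the
registered stub `stub_cylinder_weighted_total` (proved independently by a stub worker); the general `m` is what the
moment method needs for polynomially weighted constant parts and for the general explicit case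
(`stub_momentRigidity_elementary_cylinders`).

Sources: M. Kontsevich, D. Zagier, *Periods* (2001), §1.2 (rules (1)–(3)). No new definitions.
-/

noncomputable section

namespace Summit.KontsevichZagierPeriods.ValuedFieldSpecialisation

open MeasureTheory Set Filter MvPolynomial
open Literature.NumberTheory.Transcendental Literature.NumberTheory.Transcendental.KZ
open Summit.KontsevichZagierPeriods.MzvKernelInKZ.Negative (isAlgebraic_natCast of_constMul_nat_sub_nsmul_mem)

variable {n : ℕ}

/-- The monomially weighted slab integrand `(x, t) ↦ t^m · ρ x` is absolutely integrable on the slab `ρ.domain × [0,1]`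
(bounded weight times `KZ.IntegralRep.integrableOn_slabDomain`). [folklore] -/
theorem integrableOn_pow_mul_slabDomain (ρ : IntegralRep n) (m : ℕ) :
    IntegrableOn (fun z : Fin (n + 1) → ℝ => z (Fin.last n) ^ m * ρ.integrand (Fin.init z)) (ρ.slabDomain 0) := by
  have hg : IntegrableOn (fun z : Fin (n + 1) → ℝ => ρ.integrand (Fin.init z)) (ρ.slabDomain 0) :=
    ρ.integrableOn_slabDomain 0
  have hmeas : MeasurableSet (ρ.slabDomain 0) := IntegralRep.measurableSet_domain_holds (ρ.slab 0)
  refine Integrable.bdd_mul (c := 1) hg ?_ ?_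
  · exact ((continuous_apply (Fin.last n)).pow m).aestronglyMeasurable
  · rw [ae_restrict_iff' hmeas]
    refine Eventually.of_forall fun z hz => ?_
    obtain ⟨-, h0, h1⟩ := hz
    simp only [Nat.cast_zero, zero_add] at h0 h1
    rw [norm_pow, Real.norm_eq_abs, abs_of_nonneg h0]
    exact pow_le_one₀ h0 h1

/-- The monomially weighted slab over `ρ`: domain `ρ.domain × [0,1]` (last coordinate), integrand `t^m · ρ x`
(existence as an integral representation). [folklore] -/
theorem exists_monomialSlab (ρ : IntegralRep n) (m : ℕ) :
    ∃ A : IntegralRep (n + 1), A.domain = ρ.slabDomain 0 ∧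
      A.integrand = fun z => z (Fin.last n) ^ m * ρ.integrand (Fin.init z) :=
  ⟨⟨ρ.slabDomain 0, fun z => z (Fin.last n) ^ m * ρ.integrand (Fin.init z), ρ.isSemialgebraic_slabDomain 0,
    IsSemialgebraicFunOn.mul_holds
      ((isSemialgebraicFunOn_aeval (ρ.isSemialgebraic_slabDomain 0) (X (Fin.last n) ^ m)).congr fun z _ => by simp)
      (ρ.slab 0).isSemialgebraicFunOn_integrand,
    integrableOn_pow_mul_slabDomain ρ m⟩, rfl, rfl⟩

/-- **Newton–Leibniz along the parameter**: the monomially weighted slab `[ρ.domain × [0,1], t^m ρ]` minus the scaled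
base `[ρ.domain, ρ/(m+1)]` is one Newton–Leibniz move, primitive `F (x, t) = t^{m+1} · ρ x / (m+1)`.
[Kontsevich–Zagier 2001, §1.2 rule (3)] [folklore] -/
theorem of_monomialSlab_sub_of_constMul_mem_newtonLeibnizRel (ρ : IntegralRep n) (m : ℕ) (A : IntegralRep (n + 1))
    (hAd : A.domain = ρ.slabDomain 0) (hAi : A.integrand = fun z => z (Fin.last n) ^ m * ρ.integrand (Fin.init z)) :
    of A - of (ρ.constMul (((m + 1 : ℕ) : ℝ)⁻¹) (isAlgebraic_natCast (m + 1)).inv) ∈ newtonLeibnizRel := by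
  have hAsa : Literature.ModelTheory.ExponentialFields.IsSemialgebraic ℚ A.domain := A.isSemialgebraic_domain
  refine ⟨n, A, ρ.constMul (((m + 1 : ℕ) : ℝ)⁻¹) (isAlgebraic_natCast (m + 1)).inv, fun _ => (0 : ℝ), fun _ => (1 : ℝ),
    fun z => z (Fin.last n) ^ (m + 1) * ((((m + 1 : ℕ) : ℝ)⁻¹) * ρ.integrand (Fin.init z)), ?_,
    ?_, ?_, fun _ _ => zero_le_one, ?_, ?_, ?_, ?_, rfl⟩
  · -- the primitive is semialgebraic on the band: a monomial times the scaled base integrand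
    have h1 : IsSemialgebraicFunOn ℚ A.domain fun z => z (Fin.last n) ^ (m + 1) :=
      (isSemialgebraicFunOn_aeval hAsa (X (Fin.last n) ^ (m + 1))).congr fun z _ => by simp
    have h2 : IsSemialgebraicFunOn ℚ A.domain fun z => (((m + 1 : ℕ) : ℝ)⁻¹) * ρ.integrand (Fin.init z) := by
      have := (ρ.constMul (((m + 1 : ℕ) : ℝ)⁻¹) (isAlgebraic_natCast (m + 1)).inv).isSemialgebraicFunOn_integrand.comp_init.mono
        (t := A.domain) (fun z hz => by rw [hAd] at hz; exact hz.1) hAsa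
      simpa using this
    exact IsSemialgebraicFunOn.mul_holds h1 h2
  · simpa using isSemialgebraicFunOn_natCast ρ.isSemialgebraic_domain 0
  · simpa using isSemialgebraicFunOn_natCast ρ.isSemialgebraic_domain 1
  · rw [hAd]
    ext z
    simp [IntegralRep.slabDomain]
  · intro x _
    simp only [Fin.snoc_last, Fin.init_snoc]
    fun_prop
  · intro x _ t _
    rw [hAi]
    simp only [Fin.snoc_last, Fin.init_snoc]
    have h := (hasDerivAt_pow (m + 1) t).mul_const ((((m + 1 : ℕ) : ℝ)⁻¹) * ρ.integrand x)
    rw [Nat.add_sub_cancel] at h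
    refine h.congr_deriv ?_
    have hm : ((m + 1 : ℕ) : ℝ) ≠ 0 := by positivity
    field_simp
  · intro x _
    simp only [Fin.snoc_last, Fin.init_snoc, IntegralRep.integrand_constMul]
    simp

/-- **All moments of a constant family**: for the `m`-th weighted version `C` of `ρ.cylinder`
(`C.domain = ρ.cylinder.domain ∩ {0 < z 0 < 1}`, `C.integrand z = (z 0)^m · ρ (tail z)`),
`(m + 1) • [C] − [ρ] ∈ KZ.relations` — the accessible identity `∫₀¹ s^m ds = 1/(m+1)` at class level.
[Kontsevich–Zagier 2001, §1.2 rules (1)–(3)] [folklore] -/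
theorem cylinder_moment_total (m : ℕ) (ρ : IntegralRep n) (C : IntegralRep (n + 1))
    (hCd : C.domain = ρ.cylinder.domain ∩ paramSlab n 0 1)
    (hCi : C.integrand = fun z => z 0 ^ m * ρ.cylinder.integrand z) :
    (m + 1) • of C - of ρ ∈ relations := by
  obtain ⟨A, hAd, hAi⟩ := exists_monomialSlab ρ m
  set ρm : IntegralRep n := ρ.constMul (((m + 1 : ℕ) : ℝ)⁻¹) (isAlgebraic_natCast (m + 1)).inv with hρm
  -- rotate coordinates so that the parameter comes first
  set e : Fin (n + 1) ≃ Fin (n + 1) := finRotate (n + 1) with he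
  set A' : IntegralRep (n + 1) := A.reindex e with hA'
  have he0 : ∀ w : Fin (n + 1) → ℝ, (fun i => w (e i)) (Fin.last n) = w 0 := by
    intro w
    simp [he]
  have heinit : ∀ w : Fin (n + 1) → ℝ, Fin.init (fun i => w (e i)) = fun i : Fin n => w i.succ := by
    intro w
    ext i
    simp [Fin.init, he, Fin.coeSucc_eq_succ]
  have hA'dom : A'.domain = {w | (fun i : Fin n => w i.succ) ∈ ρ.domain ∧ (0 : ℝ) ≤ w 0 ∧ w 0 ≤ 1} := by
    ext w
    simp only [hA', IntegralRep.reindex_domain, hAd, IntegralRep.slabDomain, mem_setOf_eq, heinit, he0,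
      Nat.cast_zero, zero_add]
  have hA'int : ∀ w, A'.integrand w = w 0 ^ m * ρ.integrand (fun i : Fin n => w i.succ) := by
    intro w
    simp only [hA', IntegralRep.reindex_integrand, hAi, heinit, he0]
  -- the weighted cylinder domain, and its relation to the rotated band (two null faces)
  have hCdom' : ρ.cylinder.domain ∩ paramSlab n 0 1 = ρ.cylinderDomain := by
    ext w
    simp only [IntegralRep.domain_cylinder, mem_inter_iff, mem_paramSlab, Rat.cast_zero, Rat.cast_one,
      IntegralRep.cylinderDomain, mem_setOf_eq]
    tauto
  have hsa : Literature.ModelTheory.ExponentialFields.IsSemialgebraic ℚ (ρ.cylinder.domain ∩ paramSlab n 0 1) :=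
    ρ.cylinder.isSemialgebraic_domain.inter (isSemialgebraic_paramSlab n 0 1)
  have hsub : ρ.cylinder.domain ∩ paramSlab n 0 1 ⊆ A'.domain := by
    intro w hw
    rw [hCdom'] at hw
    rw [hA'dom]
    exact ⟨hw.2.2, hw.1.le, hw.2.1.le⟩
  have hnull : volume (A'.domain \ (ρ.cylinder.domain ∩ paramSlab n 0 1)) = 0 := by
    have hface : ∀ c : ℝ, volume {w : Fin (n + 1) → ℝ | w 0 = c} = 0 := fun c => by
      simpa [volume_pi] using Measure.pi_hyperplane (fun _ : Fin (n + 1) => (volume : Measure ℝ)) 0 c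
    refine measure_mono_null (fun w hw => ?_) (measure_union_null (hface 0) (hface 1))
    obtain ⟨hwA, hwc⟩ := hw
    rw [hA'dom] at hwA
    rw [hCdom'] at hwc
    obtain ⟨hx, h0, h1⟩ := hwA
    simp only [mem_union, mem_setOf_eq]
    by_contra hcon
    push Not at hcon
    exact hwc ⟨lt_of_le_of_ne h0 (Ne.symm hcon.1), lt_of_le_of_ne h1 hcon.2, hx⟩
  have h1 : of A' - of (A'.restrict _ hsa hsub) ∈ relations := A'.of_sub_of_restrict_mem_relations hsa hsub hnull
  have h2 : of (A'.restrict _ hsa hsub) - of C ∈ relations :=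
    of_sub_of_mem_relations_of_eqOn hCd fun w _ => by
      rw [IntegralRep.integrand_restrict, hA'int, hCi, IntegralRep.integrand_cylinder]
  have h3 : of A - of A' ∈ relations := of_sub_of_reindex_mem_relations _ e
  have h4 : of A - of ρm ∈ relations :=
    newtonLeibnizRel_subset_relations (of_monomialSlab_sub_of_constMul_mem_newtonLeibnizRel ρ m A hAd hAi)
  -- `(m+1) • [ρ/(m+1)] ≡ [ρ]`
  have h5 : of (ρm.constMul ((m + 1 : ℕ) : ℝ) (isAlgebraic_natCast (m + 1))) - (m + 1) • of ρm ∈ relations := by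
    simpa using of_constMul_nat_sub_nsmul_mem (m + 1) ρm
  have h6 : of (ρm.constMul ((m + 1 : ℕ) : ℝ) (isAlgebraic_natCast (m + 1))) - of ρ ∈ relations :=
    of_sub_of_mem_relations_of_eqOn rfl fun x _ => by
      simp only [hρm, IntegralRep.integrand_constMul]
      have hm : ((m + 1 : ℕ) : ℝ) ≠ 0 := by positivity
      field_simp
  have key : (m + 1) • of C - of ρ =
      -((m + 1) • ((of A - of A') + (of A' - of (A'.restrict _ hsa hsub)) + (of (A'.restrict _ hsa hsub) - of C)))
        + (m + 1) • (of A - of ρm)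
        - (of (ρm.constMul ((m + 1 : ℕ) : ℝ) (isAlgebraic_natCast (m + 1))) - (m + 1) • of ρm)
        + (of (ρm.constMul ((m + 1 : ℕ) : ℝ) (isAlgebraic_natCast (m + 1))) - of ρ) := by
    simp only [smul_sub, smul_add]
    abel
  rw [key]
  refine relations.add_mem (relations.sub_mem (relations.add_mem (relations.neg_mem ?_) ?_) h5) h6
  · exact relations.nsmul_mem (relations.add_mem (relations.add_mem h3 h1) h2) _
  · exact relations.nsmul_mem h4 _


/-- **Registered stub `stub_cylinder_weighted_total`** (the first moment, `m = 1`): for the `s`-weighted version `C` of a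
constant family, `2 • [C] − [ρ] ∈ KZ.relations` (`∫₀¹ s ds = 1/2` at class level); from `cylinder_moment_total`.
[Kontsevich–Zagier 2001, §1.2] [folklore] -/
theorem stub_cylinder_weighted_total : ∀ (n : ℕ) (ρ : Literature.NumberTheory.Transcendental.KZ.IntegralRep n) (C : Literature.NumberTheory.Transcendental.KZ.IntegralRep (n + 1)), C.domain = ρ.cylinder.domain ∩ Literature.NumberTheory.Transcendental.KZ.paramSlab n 0 1 → C.integrand = (fun z => z 0 ^ 1 * ρ.cylinder.integrand z) → 2 • Literature.NumberTheory.Transcendental.KZ.of C - Literature.NumberTheory.Transcendental.KZ.of ρ ∈ Literature.NumberTheory.Transcendental.KZ.relations := by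
  intro n ρ C hCd hCi
  have h := cylinder_moment_total 1 ρ C hCd hCi
  rwa [one_add_one_eq_two] at h

end Summit.KontsevichZagierPeriods.ValuedFieldSpecialisation
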